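import Literature.IUT.HodgeArakelov.PlusMinusTowerCyclicToy
import Literature.IUT.HodgeArakelov.DihedralCuspToyGroup
import Literature.IUT.HodgeArakelov.LabCuspStructureNonVacuity

/-!
# A CLOSED tower with exactly `l` label classes of cusps: `LabCuspStructure` is inhabited (the DIHEDRAL CUSP TOY)

S. Mochizuki, *Inter-universal Teichmüller theory II*, kurims manuscript (Dec. 2020), §2 Def 2.3 (i)–(iii) pp. 67–68:
«`LabCusp^±(Π_v)` … the set of `±`-label classes of cusps of `Π_v` … admits a natural action by `𝔽_l^×` …» (a set of
cardinality `l`, [IUTchI] Def 6.1 (iii)) [claim: Mochizuki2012, status: disputed] (IUTchII §2 Def 2.3 (iii), kurims p.68)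
(D-0012 claim key; nothing printed is asserted here).

CONSISTENCY WITNESS, TOY — consistency ≠ faithfulness; no side taken on anything printed. abc-iut-L6-t1's interface
`LabCuspStructure C` ([IUTchII] Def 2.3 (iii); `LabelClassesOfCusps.lean`) had NO positive kernel inhabitant: over every
tower whose label set `LabCusp^±(Π_v) = LabCuspPM C W.piV W.piPM` is a subsingleton it is EMPTY (abc-iut-w5-d028,
`LabCuspStructure.not_nonempty_of_subsingleton`, `…_of_piV_eq_bot`) — in particular over the cyclic toy of
`PlusMinusTowerCyclicToy.lean` (`Π_v = 1`).  This file builds the **dihedral cusp toy**: `l` an odd prime, `m := 3^l`,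
`Π_v = Π^±_v := D_m` (discrete dihedral group of order `2·3^l`) embedded as `D_m × 1` in `Π̂^cor_v := D_m × (ℤ/2 × ℤ/l × ℤ/l)`,
`Π̂_v := D_m × 1 ⊆ Π̂^±_v := D_m × (0 × 0 × ℤ/l)` (indices `l`, `2l` as printed in Def 2.3 (i)), `G_v := 1`, `k := ℂ`; the
CUSPIDAL INERTIA SUBGROUPS of `Π_v` are declared to be the `l` dihedral subgroups `K_{3^t} × 1 = ⟨r^{3^t}, s⟩ × 1`
(`t ∈ ℤ/l`).  Since `m` is odd each `K_{3^t}` is SELF-NORMALISING in `D_m` (`DihedralCuspToyGroup.normalizer_dsub_eq`) and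
`K_{3^s}`, `K_{3^t}` have non-conjugate normalisers for `s ≠ t` (rotation content), the typed label relation `labelRel`
separates them: `labCuspEquiv : ZMod l ≃ LabCuspPM C W.piV W.piPM`, whence — by abc-iut-w5-d028's
`LabCuspStructure.nonempty_iff_nonempty_equiv`, imported BY NAME — **`nonempty_labCuspStructure`**, the first positive
inhabitant of `LabCuspStructure` in the tree (closed instance at `l = 3`).  abc-iut cell, NV-L6 wave, seat abc-iut-w5-d243
(row «NV-L6/LabCuspStructure-CLOSED», proposal 03:59:37Z). [claim: Mochizuki2012, status: disputed]
(IUTchII §2 Def 2.3 (iii), kurims p.68)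
-/

noncomputable section

namespace Literature.IUT.HodgeArakelov

namespace DihedralCuspToy

open DihedralGroup CyclicToy

/-- The discrete topology on the dihedral groups (Mathlib carries none); SCOPED to this namespace (open
`DihedralCuspToy` to use the toy). [claim: Mochizuki2012, status: disputed] (IUTchII §1, kurims p.20) -/
scoped instance instTopologicalSpaceDihedral (n : ℕ) : TopologicalSpace (DihedralGroup n) := ⊥

/-- The dihedral groups are discrete. [claim: Mochizuki2012, status: disputed] (IUTchII §1, kurims p.20) -/
scoped instance instDiscreteTopologyDihedral (n : ℕ) : DiscreteTopology (DihedralGroup n) := ⟨rfl⟩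

variable (l p : ℕ) (hl : l.Prime) (hl2 : l ≠ 2) (hp : p.Prime) (hp2 : p ≠ 2) (hpl : p ≠ l)

/-- `Π_v = Π^±_v` of the toy: `D_{3^l}`. [claim: Mochizuki2012, status: disputed] (IUTchII §2 Def 2.3 (i), kurims p.67) -/
abbrev Dm : Type := DihedralGroup (3 ^ l)

/-- `Π̂^cor_v` of the toy: `D_{3^l} × (ℤ/2 × ℤ/l × ℤ/l)`.
[claim: Mochizuki2012, status: disputed] (IUTchII §2 Def 2.3 (i), kurims p.67) -/
abbrev Cor : Type := Dm l × Amb l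

/-! ## 1. The setting, the coverings and the tower -/

/-- The toy `ThetaSetting` with `Π_v := D_{3^l}` (discrete), `G_v := 1`, `k := ℂ`, trivial model environment.
[claim: Mochizuki2012, status: disputed] (IUTchII §1, kurims p.20) -/
@[reducible] def dSetting : ThetaSetting.{0} where
  N := 1
  l := l
  l_prime := hl
  l_odd := hl2
  p := p
  p_prime := hp
  p_odd := hp2
  p_ne_l := hpl
  k := ℂ
  hasPrimitiveRoot := ⟨Complex.exp (2 * Real.pi * Complex.I / (4 * l : ℕ)),
    Complex.isPrimitiveRoot_exp (4 * l) (by have := hl.pos; omega)⟩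
  PiX := TopGroup.of (Dm l)
  Gk := TopGroup.of (Multiplicative (ZMod 1))
  aug := 1
  aug_continuous := continuous_of_discreteTopology
  aug_surjective := fun _ => ⟨1, Subsingleton.elim _ _⟩
  modelPi := TopGroup.of (Multiplicative (ZMod 1))
  modelD := ⊤
  modelD_inn := le_top
  modelD_continuous := fun φ _ => ⟨continuous_of_discreteTopology, continuous_of_discreteTopology⟩
  modelTheta := ∅

/-- The toy `BadPlaceSetting`: `Π^tp_{X_v} := Π_v = D_{3^l}` with the identity inclusion, reference coverings `⊤`.
[claim: Mochizuki2012, status: disputed] (IUTchII §2 Prop 2.1, kurims pp.64-65) -/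
@[reducible] def dBadPlaceSetting : BadPlaceSetting.{0} where
  toThetaSetting := dSetting l p hl hl2 hp hp2 hpl
  PiXplain := TopGroup.of (Dm l)
  inclPlain := MonoidHom.id _
  inclPlain_isOpenEmbedding := Topology.IsOpenEmbedding.id
  refY := ⊤
  refYdd := ⊤
  refYdd_le := le_rfl
  isOpen_refY := isOpen_univ
  isOpen_refYdd := isOpen_univ

/-- The toy `TemperedCoverings` over `P := Π_v`: the reference diagram itself.
[claim: Mochizuki2012, status: disputed] (IUTchII §2 Prop 2.1, kurims pp.64-65) -/
@[reducible] def dCoverings : TemperedCoverings (dBadPlaceSetting l p hl hl2 hp hp2 hpl)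
    (dBadPlaceSetting l p hl hl2 hp hp2 hpl).PiX where
  isoRef := ⟨ContinuousMulEquiv.refl _⟩
  Xplain := TopGroup.of (Dm l)
  incl := MonoidHom.id _
  incl_isOpenEmbedding := Topology.IsOpenEmbedding.id
  Y := ⊤
  Ydd := ⊤
  Ydd_le := le_rfl
  isOpen_Y := isOpen_univ
  isOpen_Ydd := isOpen_univ
  corresponds := ⟨ContinuousMulEquiv.refl _, ContinuousMulEquiv.refl _, fun _ => rfl,
    Subgroup.map_id ⊤, Subgroup.map_id ⊤⟩

/-- `[Π̂^cor_v : D_m × (0×0×ℤ/l)] = 2l`. [claim: Mochizuki2012, status: disputed] (IUTchII §2 Def 2.3 (i), kurims p.67) -/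
theorem index_top_prod_Hpm (hl0 : l ≠ 0) : ((⊤ : Subgroup (Dm l)).prod (Hpm l)).index = 2 * l := by
  rw [Subgroup.index_prod, Subgroup.index_top, one_mul, index_Hpm l hl0]

/-- `[Π̂^cor_v : D_m × 1] = 2 l²`. [claim: Mochizuki2012, status: disputed] (IUTchII §2 Def 2.3 (i), kurims p.67) -/
theorem index_top_prod_bot : ((⊤ : Subgroup (Dm l)).prod (⊥ : Subgroup (Amb l))).index = 2 * (l * l) := by
  rw [Subgroup.index_prod, Subgroup.index_top, one_mul, Subgroup.index_bot, card_Amb]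

/-- `[D_m × (0×0×ℤ/l) : D_m × 1] = l`. [claim: Mochizuki2012, status: disputed] (IUTchII §2 Def 2.3 (i), kurims p.67) -/
theorem relIndex_hat_pmHat (hl0 : l ≠ 0) :
    ((⊤ : Subgroup (Dm l)).prod (⊥ : Subgroup (Amb l))).relIndex ((⊤ : Subgroup (Dm l)).prod (Hpm l)) = l := by
  have h := Subgroup.relIndex_mul_index
    (show (⊤ : Subgroup (Dm l)).prod (⊥ : Subgroup (Amb l)) ≤ (⊤ : Subgroup (Dm l)).prod (Hpm l) from
      Subgroup.prod_mono le_rfl bot_le)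
  rw [index_top_prod_Hpm l hl0, index_top_prod_bot] at h
  have h' : ((⊤ : Subgroup (Dm l)).prod (⊥ : Subgroup (Amb l))).relIndex ((⊤ : Subgroup (Dm l)).prod (Hpm l)) *
      (2 * l) = l * (2 * l) := by rw [h]; ring
  exact Nat.eq_of_mul_eq_mul_right (by omega) h'

/-- **The toy `PlusMinusTower`**: `Π̂^cor_v := D_m × (ℤ/2×ℤ/l×ℤ/l)`, `Π̂^±_v := D_m × (0×0×ℤ/l)`, `Π̂_v := D_m × 1`
(`= Π_v = Π^±_v` embedded by `inl`), `G_v := 1`; printed indices `l` and `2l`.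
[claim: Mochizuki2012, status: disputed] (IUTchII §2 Def 2.3 (i), kurims p.67) -/
@[reducible] def dTower : PlusMinusTower (dCoverings l p hl hl2 hp hp2 hpl) where
  Corhat := TopGroup.of (Cor l)
  cor := ⊤
  pmHat := (⊤ : Subgroup (Dm l)).prod (Hpm l)
  hat := (⊤ : Subgroup (Dm l)).prod ⊥
  emb := MonoidHom.inl (Dm l) (Amb l)
  emb_injective := fun a b h => (Prod.mk.inj h).1
  aug := 1
  aug_surjective := fun _ => ⟨1, Subsingleton.elim _ _⟩
  hat_le_pmHat := Subgroup.prod_mono le_rfl bot_le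
  emb_le_pmHat := by
    rintro _ ⟨h, rfl⟩
    exact Subgroup.mem_prod.mpr ⟨Subgroup.mem_top _, Subgroup.one_mem _⟩
  embP_le_hat := by
    rintro _ ⟨h, rfl⟩
    exact Subgroup.mem_prod.mpr ⟨Subgroup.mem_top _, Subgroup.one_mem _⟩
  embP_le_cor := le_top
  pmHat_normal := inferInstance
  deltaHat_normal := by rw [MonoidHom.ker_one, inf_top_eq, inf_top_eq]; infer_instance
  deltaHat_index := by
    rw [MonoidHom.ker_one, inf_top_eq, inf_top_eq]
    exact relIndex_hat_pmHat l hl.ne_zero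
  deltaPmHat_normal := by rw [MonoidHom.ker_one, inf_top_eq]; infer_instance
  deltaPmHat_index := by
    rw [MonoidHom.ker_one, inf_top_eq]
    change ((⊤ : Subgroup (Dm l)).prod (Hpm l)).relIndex ⊤ = 2 * l
    rw [Subgroup.relIndex_top_right, index_top_prod_Hpm l hl.ne_zero]
  aug_compat := ⟨ContinuousMulEquiv.refl _, fun _ => Subsingleton.elim _ _⟩

/-- `Π^±_v` of the toy is `D_m × 1`: membership. [claim: Mochizuki2012, status: disputed] (IUTchII §2 Def 2.3 (i), kurims p.67) -/
theorem mem_piPM_iff {x : Cor l} : x ∈ (dTower l p hl hl2 hp hp2 hpl).piPM ↔ x.2 = 1 := by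
  constructor
  · rintro ⟨h, rfl⟩
    rfl
  · intro hx
    exact ⟨x.1, Prod.ext rfl hx.symm⟩

/-- `Π_v = Π^±_v` in the toy (the inclusion `Π_v ↪ Π^tp_{X_v}` is the identity).
[claim: Mochizuki2012, status: disputed] (IUTchII §2 Def 2.3 (i), kurims p.67) -/
theorem piV_eq_piPM : (dTower l p hl hl2 hp hp2 hpl).piV = (dTower l p hl hl2 hp hp2 hpl).piPM := by
  show ((MonoidHom.inl (Dm l) (Amb l)).comp (MonoidHom.id (Dm l))).range = (MonoidHom.inl (Dm l) (Amb l)).range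
  rw [MonoidHom.comp_id]

/-! ## 2. The cusps: `K_{3^t} × 1`, `t ∈ ℤ/l` -/

/-- The `t`-th cuspidal inertia subgroup of the toy: `K_{3^{t}} × 1 ⊆ D_m × 1 = Π_v` (`t ∈ ℤ/l` read as `0 ≤ t < l`).
[claim: Mochizuki2012, status: disputed] (IUTchII §2 Def 2.3 (ii), kurims p.68) -/
def cusp (t : ZMod l) : Subgroup (Cor l) := (dsub (3 ^ l) ((3 ^ t.val : ℕ) : ZMod (3 ^ l))).prod ⊥

/-- Cusps lie in `Π_v`. [claim: Mochizuki2012, status: disputed] (IUTchII §2 Def 2.3 (ii), kurims p.68) -/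
theorem cusp_le_piV (t : ZMod l) : cusp l t ≤ (dTower l p hl hl2 hp hp2 hpl).piV := by
  rw [piV_eq_piPM]
  intro x hx
  exact (mem_piPM_iff l p hl hl2 hp hp2 hpl).mpr (Subgroup.mem_prod.mp hx).2

/-- **The toy `CuspidalInertiaData`**: the cuspidal inertia subgroups of any `Q` are the `K_{3^t} × 1` contained in `Q`.
[claim: Mochizuki2012, status: disputed] (IUTchII §2 Def 2.3 (ii), kurims p.68) -/
@[reducible] def dCusps : CuspidalInertiaData (dTower l p hl hl2 hp hp2 hpl) where
  IsCuspidalInertia Q I := I ≤ Q ∧ ∃ t : ZMod l, I = cusp l t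
  le_of_isCuspidalInertia h := h.1

/-- The normaliser bookkeeping of `labelRel`, computed: for every cusp, `N_{Π^±_v}(K_{3^t} × 1) = K_{3^t} × 1` (self-normalising,
`m = 3^l` odd). [claim: Mochizuki2012, status: disputed] (IUTchII §2 Def 2.3 (iii), kurims p.68) -/
theorem normalizerMap_cusp (t : ZMod l) :
    (Subgroup.normalizer (((cusp l t).subgroupOf (dTower l p hl hl2 hp hp2 hpl).piPM :
        Subgroup (dTower l p hl hl2 hp hp2 hpl).piPM) : Set (dTower l p hl hl2 hp hp2 hpl).piPM)).map
      (dTower l p hl hl2 hp hp2 hpl).piPM.subtype = cusp l t := by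
  set W := dTower l p hl hl2 hp hp2 hpl with hW
  -- the projection `Π^±_v = D_m × 1 → D_m`
  let ψ : ↥W.piPM →* Dm l := (MonoidHom.fst (Dm l) (Amb l)).comp W.piPM.subtype
  have hψ : Function.Surjective ψ := fun h =>
    ⟨⟨(h, 1), (mem_piPM_iff l p hl hl2 hp hp2 hpl).mpr rfl⟩, rfl⟩
  have hsub : (cusp l t).subgroupOf W.piPM = (dsub (3 ^ l) ((3 ^ t.val : ℕ) : ZMod (3 ^ l))).comap ψ := by
    ext x
    have hx2 : (x : Cor l).2 = 1 := (mem_piPM_iff l p hl hl2 hp hp2 hpl).mp x.2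
    rw [Subgroup.mem_subgroupOf, cusp, Subgroup.mem_prod, Subgroup.mem_comap, hx2]
    exact ⟨fun h => h.1, fun h => ⟨h, Subgroup.one_mem _⟩⟩
  rw [hsub, ← Subgroup.comap_normalizer_eq_of_surjective _ hψ, normalizer_dsub_eq _ (odd_three_pow l), ← hsub,
    Subgroup.subgroupOf_map_subtype]
  exact inf_eq_left.mpr ((cusp_le_piV l p hl hl2 hp hp2 hpl t).trans_eq (piV_eq_piPM l p hl hl2 hp hp2 hpl))

/-- Undoing a conjugation. [claim: Mochizuki2012, status: disputed] (IUTchII §2 Def 2.3 (iii), kurims p.68) -/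
theorem map_conj_inv_map_conj {G : Type} [Group G] (X : Subgroup G) (g : G) :
    (X.map (MulAut.conj g).toMonoidHom).map (MulAut.conj g⁻¹).toMonoidHom = X := by
  rw [Subgroup.map_map]
  have : (MulAut.conj g⁻¹).toMonoidHom.comp (MulAut.conj g).toMonoidHom = MonoidHom.id G := by
    ext x
    simp only [MonoidHom.coe_comp, Function.comp_apply, MulEquiv.coe_toMonoidHom, MulAut.conj_apply,
      MonoidHom.id_apply]
    group
  rw [this, Subgroup.map_id]

/-- Rotation content of a conjugate cusp: if `K_{3^t} × 1 = g (K_{3^s} × 1) g⁻¹` with `g ∈ Π^±_v`, then `t ≤ s`.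
[claim: Mochizuki2012, status: disputed] (IUTchII §2 Def 2.3 (iii), kurims p.68) -/
theorem val_le_of_cusp_eq_map_conj {s t : ZMod l} {g : Cor l} (hg : g ∈ (dTower l p hl hl2 hp hp2 hpl).piPM)
    (h : cusp l t = (cusp l s).map (MulAut.conj g).toMonoidHom) : t.val ≤ s.val := by
  haveI : NeZero l := ⟨hl.ne_zero⟩
  have hg2 : g.2 = 1 := (mem_piPM_iff l p hl hl2 hp hp2 hpl).mp hg
  -- `(r^{3^s}, 1) ∈ K_{3^s} × 1`, hence its `g`-conjugate lies in `K_{3^t} × 1`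
  have hmem : (r ((3 ^ s.val : ℕ) : ZMod (3 ^ l)), (1 : Amb l)) ∈ cusp l s :=
    Subgroup.mem_prod.mpr ⟨r_self_mem_dsub _ _, Subgroup.one_mem _⟩
  have hconj : g * (r ((3 ^ s.val : ℕ) : ZMod (3 ^ l)), (1 : Amb l)) * g⁻¹ ∈ cusp l t := by
    rw [h, Subgroup.mem_map]
    exact ⟨_, hmem, rfl⟩
  have hfst : (g * (r ((3 ^ s.val : ℕ) : ZMod (3 ^ l)), (1 : Amb l)) * g⁻¹).1 =
      g.1 * r ((3 ^ s.val : ℕ) : ZMod (3 ^ l)) * g.1⁻¹ := rfl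
  have hrot : r ((3 ^ s.val : ℕ) : ZMod (3 ^ l)) ∈ dsub (3 ^ l) ((3 ^ t.val : ℕ) : ZMod (3 ^ l)) := by
    have h1 := (Subgroup.mem_prod.mp hconj).1
    rw [hfst] at h1
    rcases conj_r (3 ^ l) g.1 ((3 ^ s.val : ℕ) : ZMod (3 ^ l)) with e | e <;> rw [e] at h1
    · exact h1
    · obtain ⟨k, hk⟩ := (r_mem_dsub_iff _ _ _).mp h1
      exact (r_mem_dsub_iff _ _ _).mpr ⟨-k, by rw [mul_neg, ← hk, neg_neg]⟩
  exact le_of_pow_three_mem_dsub (le_of_lt (ZMod.val_lt t)) hrot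

/-- **The label relation separates the `l` cusps**: `labelRel (K_{3^s} × 1) (K_{3^t} × 1) → s = t`.
[claim: Mochizuki2012, status: disputed] (IUTchII §2 Def 2.3 (iii), kurims p.68) -/
theorem eq_of_labelRel {s t : ZMod l}
    (hs : (dCusps l p hl hl2 hp hp2 hpl).IsCuspidalInertia (dTower l p hl hl2 hp hp2 hpl).piV (cusp l s))
    (ht : (dCusps l p hl hl2 hp hp2 hpl).IsCuspidalInertia (dTower l p hl hl2 hp hp2 hpl).piV (cusp l t))
    (h : labelRel (dCusps l p hl hl2 hp hp2 hpl) (dTower l p hl hl2 hp hp2 hpl).piV (dTower l p hl hl2 hp hp2 hpl).piPM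
      ⟨cusp l s, hs⟩ ⟨cusp l t, ht⟩) : s = t := by
  haveI : NeZero l := ⟨hl.ne_zero⟩
  obtain ⟨g, hg, hN⟩ := h
  have hN₀ : cusp l t = (cusp l s).map (MulAut.conj g).toMonoidHom := by
    have e₁ := normalizerMap_cusp l p hl hl2 hp hp2 hpl t
    have e₂ := normalizerMap_cusp l p hl hl2 hp hp2 hpl s
    rw [← e₁, ← e₂]
    exact hN
  have h1 := val_le_of_cusp_eq_map_conj l p hl hl2 hp hp2 hpl hg hN₀
  have hN' : cusp l s = (cusp l t).map (MulAut.conj g⁻¹).toMonoidHom := by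
    rw [hN₀, map_conj_inv_map_conj]
  have h2 := val_le_of_cusp_eq_map_conj l p hl hl2 hp hp2 hpl ((dTower l p hl hl2 hp hp2 hpl).piPM.inv_mem hg) hN'
  exact ZMod.val_injective l (le_antisymm h2 h1)

/-! ## 3. `LabCusp^±(Π_v) ≃ 𝔽_l` and the inhabited `LabCuspStructure` -/

/-- The cusps are distinct: `K_{3^s} × 1 = K_{3^t} × 1 → s = t`.
[claim: Mochizuki2012, status: disputed] (IUTchII §2 Def 2.3 (iii), kurims p.68) -/
theorem cusp_injective (hl0 : l ≠ 0) : Function.Injective (cusp l : ZMod l → Subgroup (Cor l)) := by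
  intro s t h
  haveI : NeZero l := ⟨hl0⟩
  have key : ∀ {a b : ZMod l}, cusp l a = cusp l b → b.val ≤ a.val := by
    intro a b hab
    have hmem : (r ((3 ^ a.val : ℕ) : ZMod (3 ^ l)), (1 : Amb l)) ∈ cusp l a :=
      Subgroup.mem_prod.mpr ⟨r_self_mem_dsub _ _, Subgroup.one_mem _⟩
    rw [hab] at hmem
    exact le_of_pow_three_mem_dsub (le_of_lt (ZMod.val_lt b)) (Subgroup.mem_prod.mp hmem).1
  exact ZMod.val_injective l (le_antisymm (key h.symm) (key h))

/-- **`LabCusp^±(Π_v) ≃ ℤ/l`** in the dihedral cusp toy: `t ↦` the label class of `K_{3^t} × 1`.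
[claim: Mochizuki2012, status: disputed] (IUTchII §2 Def 2.3 (iii), kurims p.68) -/
def labCuspEquiv :
    ZMod l ≃ LabCuspPM (dCusps l p hl hl2 hp hp2 hpl) (dTower l p hl hl2 hp hp2 hpl).piV
      (dTower l p hl hl2 hp hp2 hpl).piPM where
  toFun t := Quot.mk _ ⟨cusp l t, cusp_le_piV l p hl hl2 hp hp2 hpl t, t, rfl⟩
  invFun := Quot.lift (fun I => Classical.choose I.2.2) (by
    rintro ⟨I, hI, s, rfl⟩ ⟨J, hJ, t, rfl⟩ h
    have hs := Classical.choose_spec (⟨s, rfl⟩ : ∃ t', cusp l s = cusp l t')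
    have ht := Classical.choose_spec (⟨t, rfl⟩ : ∃ t', cusp l t = cusp l t')
    change Classical.choose (⟨s, rfl⟩ : ∃ t', cusp l s = cusp l t') =
      Classical.choose (⟨t, rfl⟩ : ∃ t', cusp l t = cusp l t')
    rw [← cusp_injective l hl.ne_zero hs, ← cusp_injective l hl.ne_zero ht]
    exact eq_of_labelRel l p hl hl2 hp hp2 hpl _ _ h)
  left_inv t := by
    change Classical.choose (⟨t, rfl⟩ : ∃ t', cusp l t = cusp l t') = t
    exact (cusp_injective l hl.ne_zero (Classical.choose_spec (⟨t, rfl⟩ : ∃ t', cusp l t = cusp l t'))).symm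
  right_inv q := by
    induction q using Quot.ind with
    | mk I =>
      obtain ⟨I, hI, s, rfl⟩ := I
      change Quot.mk _ _ = Quot.mk _ _
      congr 2
      exact congrArg (cusp l)
        (cusp_injective l hl.ne_zero (Classical.choose_spec (⟨s, rfl⟩ : ∃ t', cusp l s = cusp l t'))).symm

/-- **`LabCuspStructure` IS INHABITED over the dihedral cusp toy** — the first positive kernel inhabitant of
abc-iut-L6-t1's interface, via abc-iut-w5-d028's `LabCuspStructure.nonempty_iff_nonempty_equiv` (imported BY NAME).
[claim: Mochizuki2012, status: disputed] (IUTchII §2 Def 2.3 (iii), kurims p.68) -/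
theorem nonempty_labCuspStructure : Nonempty (LabCuspStructure (dCusps l p hl hl2 hp hp2 hpl)) :=
  LabCuspStructure.nonempty_iff_nonempty_equiv.mpr ⟨(labCuspEquiv l p hl hl2 hp hp2 hpl).symm⟩

/-- **Closed instance** (`l := 3`, `p := 5`): there exist, in the kernel, a bad-place setting, coverings, a `±`-tower
and cuspidal inertia data over them whose `LabCuspStructure` is inhabited.
[claim: Mochizuki2012, status: disputed] (IUTchII §2 Def 2.3 (iii), kurims p.68) -/
theorem exists_nonempty_labCuspStructure :
    ∃ (S : BadPlaceSetting.{0}) (T : TemperedCoverings S S.PiX) (W : PlusMinusTower T) (C : CuspidalInertiaData W),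
      Nonempty (LabCuspStructure C) :=
  ⟨_, _, _, _, nonempty_labCuspStructure 3 5 Nat.prime_three (by decide) Nat.prime_five (by decide) (by decide)⟩

end DihedralCuspToy

end Literature.IUT.HodgeArakelov

end
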